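import Summits.HodgeConjecture.CorCM.SharedImaginaryQuadraticCMFieldsHodge
import Literature.AlgebraicGeometry.Pohlmann1968.CMTypeRankLowerBoundsNumberField
import HarnessLib

/-!
# Two simple CM abelian THREEFOLDS with Galois (cyclic sextic) CM fields: the Hodge conjecture on every `A₀^a × A₁^b`
# iff `[L₀ ∩ L₁ : ℚ]` is odd; an exceptional Hodge class on some product iff it is even

COR-CM (cell `pub-hodgecm2`, binder seat `b23` gen 28), count-neutral; NEW as stated, hence under `Summits/`.  Packaged
instance of this seat's parity theorems (`GaloisCMFieldsTwiceOddDegreePair`, `SharedImaginaryQuadraticCMFieldsHodge`: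
degree `2m`, `m` odd; here `m = 3`) for two simple CM abelian threefolds `A₀`, `A₁` whose sextic CM fields are GALOIS over
`ℚ` — necessarily cyclic, `K_i = k_i · C_i` with `k_i` imaginary quadratic and `C_i` a cyclic cubic (e.g. `ℚ(ζ_7)`,
`ℚ(ζ_9)`, `ℚ(√−d)·ℚ(ζ_7)⁺`).  Primitive sextic types are nondegenerate (Ribet's bound in degree `≤ 6`), so with
`d = [L₀ ∩ L₁ : ℚ] ∈ {1, 2, 3, 6}`:

* **`isNondegenerateFamily_galoisSexticThreefolds_iff_odd`** — simple `A_i` (primitive types): the pair is nondegenerate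
  iff `d` is odd (`d ∈ {1, 3}`: the fields meet in `ℚ` or in a common real cubic field);
* **`hodgeConjectureFor_prod_galoisSexticThreefolds_of_odd`** — `d` odd: the Hodge conjecture and `B• = D•` on every
  `A₀^a × A₁^b` (every `⨁_{j<N} A_{π j}`), UNCONDITIONALLY;
* **`exists_exceptional_prod_galoisSexticThreefolds_iff_even`** — simple, NON-ISOGENOUS `A_i`: an exceptional Hodge class
  on some `A₀^a × A₁^b` iff `d` is even (`d ∈ {2, 6}`: the fields share their imaginary quadratic subfield `k₀ = k₁`,
  e.g. `ℚ(ζ_7)` and `ℚ(√−7)·ℚ(ζ_9)⁺`, or coincide);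
* `forall_prod_hodgeClassSpan_eq_galoisSexticThreefolds_iff_odd` — `B• = D•` everywhere iff `d` odd.

Theorems only, no definition, no `sorry`.

## References

* [Gordon1999HodgeAVSurvey] B. B. Gordon, *A survey of the Hodge conjecture for abelian varieties*, §3 Theorem, 7.4–7.7,
  10.10; Ribet's bound (3.7).
* [Rotman1995] J. J. Rotman, *An Introduction to the Theory of Groups*, 4th ed., GTM 148, Thm. 7.41.
* [Deligne1982HodgeCycles] P. Deligne, *Hodge cycles on abelian varieties*, LNM 900 (1982), §4.
-/

noncomputable section

open CategoryTheory CategoryTheory.Limits NumberField IntermediateField Module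

namespace Summit.HodgeConjecture.CorCM

open Literature.NumberTheory.ComplexMultiplication
open Literature.AlgebraicGeometry.Motives (AbelianVariety CMType)
open Literature.AlgebraicGeometry.HodgeTheory
open Literature.AlgebraicGeometry.ComplexMultiplication (IsCMTypeRealisation isSimple_iff_isPrimitive)
open Literature.AlgebraicGeometry.VanGeemen1994 (hodgeClassSpan)
open Literature.AlgebraicGeometry.Pohlmann1968
open Literature.Barriers.HodgeConjecture (divisorClassesSpan)

variable {I : Type} {K : I → Type} [∀ i, Field (K i)] [∀ i, NumberField (K i)] [∀ i, IsCMField (K i)] [Fintype I]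
  [Nonempty I] {Φ : ∀ i, CMType (K i)}
variable {A : I → AbelianVariety ℂ} {ι : ∀ i, 𝓞 (K i) →+* End (A i)}
  {θ : ∀ i, K i →+* Module.End ℂ (complexBetti (A i).X 1)}

omit [Fintype I] [Nonempty I] in
/-- Simple realisations of sextic types are realisations of nondegenerate types (primitive by simplicity, nondegenerate
by Ribet's bound in degree `≤ 6`). [cite: Gordon1999HodgeAVSurvey, Ribet (3.7)] -/
theorem isNondegenerate_of_isSimple_of_finrank_eq_six {i : I} (h6 : finrank ℚ (K i) = 6)
    (hA : IsCMTypeRealisation (Φ i) (A i) (ι i) (θ i)) (hS : (A i).IsSimple) : IsNondegenerate (Φ i) := by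
  obtain ⟨φ₀⟩ : Nonempty (K i →+* ℂ) := inferInstance
  exact isNondegenerate_of_isPrimitive_of_finrank_le_six (Φ i) (by omega) φ₀ ((isSimple_iff_isPrimitive hA φ₀).1 hS)

/-- **Two simple CM threefolds with Galois sextic CM fields: the pair is nondegenerate iff `[L₀ ∩ L₁ : ℚ]` is odd.**
[cite: Gordon1999HodgeAVSurvey, §3 Theorem and 7.5–7.7] [cite: Rotman1995, Thm. 7.41] -/
theorem isNondegenerateFamily_galoisSexticThreefolds_iff_odd {i₀ i₁ : I} (h01 : i₀ ≠ i₁) (hI : ∀ j, j = i₀ ∨ j = i₁)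
    [IsGalois ℚ (K i₀)] [IsGalois ℚ (K i₁)] (h6 : ∀ i, finrank ℚ (K i) = 6)
    (hA : ∀ i, IsCMTypeRealisation (Φ i) (A i) (ι i) (θ i)) (hS : ∀ i, (A i).IsSimple) :
    CMAlgebra.IsNondegenerateFamily Φ ↔ Odd (finrank ℚ ↥(normalClosure ℚ (K i₀) ℂ ⊓ normalClosure ℚ (K i₁) ℂ)) := by
  rw [isNondegenerateFamily_iff_of_twice_odd' (m₁ := 3) (by decide) h01 hI (by rw [h6 i₁])]
  exact ⟨fun h => h.1, fun h => ⟨h, fun i => isNondegenerate_of_isSimple_of_finrank_eq_six (h6 i) (hA i) (hS i)⟩⟩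

/-- **`[L₀ ∩ L₁ : ℚ]` odd (the fields meet in `ℚ` or in a common real cubic): the Hodge conjecture and `B• = D•` on
every `A₀^a × A₁^b` of two simple CM threefolds with Galois sextic CM fields**, UNCONDITIONALLY — e.g. `ℚ(ζ_7) × ℚ(ζ_9)`,
`ℚ(ζ_7) × ℚ(√−3)·ℚ(ζ_7)⁺`. [cite: Gordon1999HodgeAVSurvey, §3 Theorem and 10.10] -/
theorem hodgeConjectureFor_prod_galoisSexticThreefolds_of_odd {i₀ i₁ : I} (h01 : i₀ ≠ i₁) (hI : ∀ j, j = i₀ ∨ j = i₁)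
    [IsGalois ℚ (K i₀)] [IsGalois ℚ (K i₁)] (h6 : ∀ i, finrank ℚ (K i) = 6)
    (hodd : Odd (finrank ℚ ↥(normalClosure ℚ (K i₀) ℂ ⊓ normalClosure ℚ (K i₁) ℂ)))
    (hA : ∀ i, IsCMTypeRealisation (Φ i) (A i) (ι i) (θ i)) (hS : ∀ i, (A i).IsSimple) {N : ℕ} (π : Fin N → I) :
    HodgeConjectureFor (⨁ fun j : Fin N => A (π j)).dim (⨁ fun j : Fin N => A (π j)).X ∧
      ∀ m : ℕ, hodgeClassSpan (⨁ fun j : Fin N => A (π j)).dim (⨁ fun j : Fin N => A (π j)).X m =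
        divisorClassesSpan (⨁ fun j : Fin N => A (π j)).X (⨁ fun j : Fin N => A (π j)).dim m :=
  have hnd := (isNondegenerateFamily_galoisSexticThreefolds_iff_odd h01 hI h6 hA hS).2 hodd
  ⟨hnd.hodgeConjectureFor_prod hA π, fun m => hnd.hodgeClassSpan_prod_eq_divisorClassesSpan hA π m⟩

/-- **`B• = D•` on every `A₀^a × A₁^b` iff `[L₀ ∩ L₁ : ℚ]` is odd** — two simple NON-ISOGENOUS CM threefolds with Galois
sextic CM fields. [cite: Gordon1999HodgeAVSurvey, §3 Theorem and 7.5–7.7] -/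
theorem forall_prod_hodgeClassSpan_eq_galoisSexticThreefolds_iff_odd {i₀ i₁ : I} (h01 : i₀ ≠ i₁)
    (hI : ∀ j, j = i₀ ∨ j = i₁) [IsGalois ℚ (K i₀)] [IsGalois ℚ (K i₁)] (h6 : ∀ i, finrank ℚ (K i) = 6)
    (hA : ∀ i, IsCMTypeRealisation (Φ i) (A i) (ι i) (θ i)) (hS : ∀ i, (A i).IsSimple)
    (hniso : ∀ i j, i ≠ j → ¬ AbelianVariety.IsIsogenous (A i) (A j)) :
    (∀ (N : ℕ) (π : Fin N → I) (m : ℕ),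
        hodgeClassSpan (⨁ fun j : Fin N => A (π j)).dim (⨁ fun j : Fin N => A (π j)).X m =
          divisorClassesSpan (⨁ fun j : Fin N => A (π j)).X (⨁ fun j : Fin N => A (π j)).dim m) ↔
      Odd (finrank ℚ ↥(normalClosure ℚ (K i₀) ℂ ⊓ normalClosure ℚ (K i₁) ℂ)) :=
  (CMAlgebra.isNondegenerateFamily_iff_forall_prod_hodgeClassSpan_eq
      (CMAlgebra.isSeparatingFamily_of_isSimple_of_pairwise_not_isIsogenous hA hS hniso) hA).symm.trans
    (isNondegenerateFamily_galoisSexticThreefolds_iff_odd h01 hI h6 hA hS)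

/-- **An exceptional Hodge class on some `A₀^a × A₁^b` iff `[L₀ ∩ L₁ : ℚ]` is even** (the fields share their
imaginary quadratic subfield, e.g. `ℚ(ζ_7)` and `ℚ(√−7)·ℚ(ζ_9)⁺`) — two simple NON-ISOGENOUS CM threefolds with Galois
sextic CM fields. [cite: Gordon1999HodgeAVSurvey, 7.5–7.7] [cite: Deligne1982HodgeCycles, §4] -/
theorem exists_exceptional_prod_galoisSexticThreefolds_iff_even {i₀ i₁ : I} (h01 : i₀ ≠ i₁)
    (hI : ∀ j, j = i₀ ∨ j = i₁) [IsGalois ℚ (K i₀)] [IsGalois ℚ (K i₁)] (h6 : ∀ i, finrank ℚ (K i) = 6)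
    (hA : ∀ i, IsCMTypeRealisation (Φ i) (A i) (ι i) (θ i)) (hS : ∀ i, (A i).IsSimple)
    (hniso : ∀ i j, i ≠ j → ¬ AbelianVariety.IsIsogenous (A i) (A j)) :
    (∃ (N : ℕ) (π : Fin N → I) (m : ℕ) (c : complexBetti (⨁ fun j : Fin N => A (π j)).X (2 * m)),
        IsRationalClass c ∧
        IsOfHodgeType (⨁ fun j : Fin N => A (π j)).dim (⨁ fun j : Fin N => A (π j)).X (2 * m) m m c ∧
        c ∉ divisorClassesSpan (⨁ fun j : Fin N => A (π j)).X (⨁ fun j : Fin N => A (π j)).dim m) ↔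
      Even (finrank ℚ ↥(normalClosure ℚ (K i₀) ℂ ⊓ normalClosure ℚ (K i₁) ℂ)) := by
  rw [exists_exceptional_prod_iff_of_twice_odd' (m₁ := 3) (by decide) h01 hI (by rw [h6 i₁])
    (CMAlgebra.isSeparatingFamily_of_isSimple_of_pairwise_not_isIsogenous hA hS hniso) hA]
  exact ⟨fun h => h.resolve_right fun ⟨i, hi⟩ => hi (isNondegenerate_of_isSimple_of_finrank_eq_six (h6 i) (hA i) (hS i)),
    Or.inl⟩

end Summit.HodgeConjecture.CorCM

end
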